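import Summits.HubbardSuperconductivity.HubbardSuperconductivity.Theorems.LogColdTorusAverageToEveryRecut

/-!
# RECUT recipe check (lead c17, crux stmt-HubbardSuperconductivity-10519)

The planner's route-edit recipe of `RECUT-c17.md` §2 ELABORATES: the candidate item `ShiftedDescent`
typed as a route-file item (fully qualified names, no `open`, the exact one-line signature recorded in
`RECUT-c17.md` §4 / the lead's `ref/sig_ShiftedDescent_fq.txt`), the closes body over the landed
certificate `Theorems.hubbardSuperconductivity_of_logColdOrder_of_shiftedDescent` (p157153), and the
dominance `LogColdToGround → AverageToEvery → ShiftedDescent`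
(`Theorems.shiftedDescent_of_logColdToGround_of_averageToEvery`). Scratch file; not a proposal.
-/

set_option linter.dupNamespace false

namespace Summit.HubbardSuperconductivity.HubbardSuperconductivity.Cruxes.AverageToEvery.Recut

-- the route file's own context (Theses/LogColdTorus.lean header), so the candidate item elaborates
-- exactly as it will inside the route file
open scoped BigOperators Topology Manifold Classical MeasureTheory ProbabilityTheory Matrix InnerProductSpace ComplexConjugate ContinuousMap
open Filter Set Function TopologicalSpace MeasureTheory
open Literature.Hubbard
open Summit.HubbardSuperconductivity.HubbardSuperconductivity.Theses.LogColdTorus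

/-- Candidate route item (replaces `LogColdToGround` + `AverageToEvery`): the merged descent crux to
the SHIFTED ground-state average, signature exactly as a planner would pass it to `workitem add`. -/
def ShiftedDescentCandidate : Prop :=
  ∀ (δ U₁ U₂ κ₀ c : ℝ), 0 < U₁ → U₁ < U₂ → 0 < κ₀ → 0 < c → (∀ κ : ℝ, κ₀ ≤ κ → ∃ L₀ : ℕ, ∀ U ∈ Set.Ioo U₁ U₂, ∀ (L : ℕ) [NeZero L], L₀ ≤ L → Even L → let p : Finset (Literature.MathematicalPhysics.QuantumLattice.Orb (Literature.MathematicalPhysics.QuantumLattice.FermionTorus 2 L)) → Prop := fun s => s.card = 2 * ⌊(1 - δ) * (L : ℝ) ^ 2 / 2⌋₊ ∧ 2 * (s.filter fun i => (ofLex i).2 = 0).card = 2 * ⌊(1 - δ) * (L : ℝ) ^ 2 / 2⌋₊; c * (L : ℝ) ^ 4 ≤ (Matrix.gibbsState (κ * Real.log L) ((Literature.MathematicalPhysics.QuantumLattice.hubbardTorus 2 L 1 U).toBlock p p) ((Matrix.conjTranspose (Literature.MathematicalPhysics.QuantumLattice.pairField Literature.MathematicalPhysics.QuantumLattice.dWaveFormFactor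 L) * Literature.MathematicalPhysics.QuantumLattice.pairField Literature.MathematicalPhysics.QuantumLattice.dWaveFormFactor L).toBlock p p)).re) → ∃ U ∈ Set.Ioo U₁ U₂, ∃ c' : ℝ, 0 < c' ∧ ∃ L₁ : ℕ, ∀ (L : ℕ) [NeZero L], L₁ ≤ L → Even L → ∃ κ : ℝ, 0 < κ ∧ let N : ℕ := 2 * ⌊(1 - δ) * (L : ℝ) ^ 2 / 2⌋₊; let H := Literature.MathematicalPhysics.QuantumLattice.hubbardTorus 2 L 1 U; let S := Literature.MathematicalPhysics.QuantumLattice.szSector (Λ := Literature.MathematicalPhysics.QuantumLattice.FermionTorus 2 L) N 0; let Yd : Matrix (Finset (Literature.MathematicalPhysics.QuantumLattice.Orb (Literature.MathematicalPhysics.QuantumLattice.FermionTorus 2 L))) (Finset (Literature.MathematicalPhysics.QuantumLattice.Orb (Literature.MathematicalPhysics.QuantumLattice.FermionTorus 2 L))) ℂ := ((1 : ℂ) / (L : ℂ) ^ 4) • (Matrix.conjTranspose (Literature.MathematicalPhysics.QuantumLattice.pairField Literature.MathematicalPhysics.QuantumLattice.dWaveFormFactor L) * Literature.MathematicalPhysics.QuantumLattice.pairField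 Literature.MathematicalPhysics.QuantumLattice.dWaveFormFactor L); let E := S ⊓ Module.End.eigenspace (Matrix.toLin' (H + (κ : ℂ) • Yd)) ((((H + (κ : ℂ) • Yd).minEnergyOn S : ℝ)) : ℂ); let P := Literature.MathematicalPhysics.QuantumLattice.projMatrix (E.map (Literature.MathematicalPhysics.QuantumLattice.Fock.toEuclidean (ι := Literature.MathematicalPhysics.QuantumLattice.Orb (Literature.MathematicalPhysics.QuantumLattice.FermionTorus 2 L)) : Literature.MathematicalPhysics.QuantumLattice.Fock (Literature.MathematicalPhysics.QuantumLattice.Orb (Literature.MathematicalPhysics.QuantumLattice.FermionTorus 2 L)) →ₗ[ℂ] EuclideanSpace ℂ (Finset (Literature.MathematicalPhysics.QuantumLattice.Orb (Literature.MathematicalPhysics.QuantumLattice.FermionTorus 2 L))))); c' * (L : ℝ) ^ 4 * P.trace.re ≤ (P * (Matrix.conjTranspose (Literature.MathematicalPhysics.QuantumLattice.pairField Literature.MathematicalPhysics.QuantumLattice.dWaveFormFactor L) * Literature.MathematicalPhysics.QuantumLattice.pairField Literature.MathematicalPhysics.QuantumLattice.dWaveFormFactor L)).trace.re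

/-- The closes-file body after the re-cut (one term over the landed certificate). -/
theorem closes_recut : LogColdDWaveOrder → ShiftedDescentCandidate → HubbardSuperconductivity :=
  fun h1 hSD => Summit.HubbardSuperconductivity.HubbardSuperconductivity.Theorems.hubbardSuperconductivity_of_logColdOrder_of_shiftedDescent h1 hSD

/-- Dominance: the candidate is implied by the two items it replaces (one term over the landed certificate). -/
theorem shiftedDescentCandidate_of : LogColdToGround → AverageToEvery → ShiftedDescentCandidate :=
  fun h2 h3 => Summit.HubbardSuperconductivity.HubbardSuperconductivity.Theorems.shiftedDescent_of_logColdToGround_of_averageToEvery h2 h3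

end Summit.HubbardSuperconductivity.HubbardSuperconductivity.Cruxes.AverageToEvery.Recut
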